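import Summits.AtomisticToContinuum.HydrodynamicLimit.Theorems.JParityClosureEvenStressEnskogTubeStatRegular
import Literature.MathematicalPhysics.KineticTheory.EvenStatTruncationBound
import HarnessLib

/-!
# The B-side of `RateFloor` at rung 0, I: marks, their speed truncation, and the pair functional
# (helper file, `--supports stmt-AtomisticToContinuum-13080`)

Crux `JParityClosure.RateFloor` (stmt-AtomisticToContinuum-13080), line `Sketch`, rung-0 stub `stub_staticOpacityFloorRung0`
("the r-scale LLN of the B-side").  Elementary algebra of the sphere-integrated mark `Θ Ξ v w` (`sphereMark`) and of the
`r`-mollified pair functional `B_r Ξ (z, x₀)` (`pairFunctional`, verbatim the crux's `B`) for a GENERAL continuous mark, used by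
the companion files `…PairFunctionalVelocityStats` and `…PairFunctionalUpperRung0`:

* `sphereMark_mono`, `sphereMark_add`, `sphereMark_nonneg'`, `sphereMark_le_mul_norm` (`Θ Ξ v w ≤ C|S²|‖w − v‖` for `0 ≤ Ξ ≤ C`);
* the speed cutoff `ψ_L(‖v′ − v‖)` (`speedCutoff`): the bounded part `Ξψ_L` (`continuous_truncMark`, `abs_truncMark_le`,
  `truncMark_eq_zero_of_le`, `abs_sphereMark_truncMark_le`: `|Θ(Ξψ_L)| ≤ C·2L·|S²|`) and the tail `Ξ(1 − ψ_L)` (`continuous_tailMark`,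
  `tailMark_nonneg_le`, `sphereMark_tail_le`: `Θ(Ξ(1−ψ_L)) v w ≤ (C|S²|/L)‖w − v‖²`);
* `pairFunctional_add`, `pairFunctional_nonneg`, `pairFunctional_tail_le`
  (`B_r(Ξ(1−ψ_L)) ≤ (4M²C|S²|/L)·(N+1)⁻¹Σᵢ‖vᵢ‖²`, `M = 3/(πr³)`);
* `abs_offDiag_sub_one_le` — the off-diagonal cone-weight pair average `Q` versus the mollified density `ρ̄`:
  `|Q − 1| ≤ (M+1)|ρ̄ − 1| + M²n⁻¹`.
-/

noncomputable section

open MeasureTheory ProbabilityTheory Set Filter Topology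
open scoped ENNReal InnerProductSpace BigOperators

namespace Summit.AtomisticToContinuum.HydrodynamicLimit.Theorems

namespace RateFloorPairFunctionalUpper

open Literature.Analysis.FluidPDE Literature.MathematicalPhysics.KineticTheory
open Summit.AtomisticToContinuum.HydrodynamicLimit.Theorems.EvenStressEnskog

/-! ## Sphere-integrated marks: bounds, monotonicity, additivity -/

/-- The sphere integrand of a continuous mark is integrable on the unit sphere. [folklore] -/
theorem integrable_sphereIntegrand {Ξ : V3 × V3 × V3 → ℝ} (hΞ : Continuous Ξ) (v w : V3) :
    Integrable (fun ω : Metric.sphere (0 : V3) 1 => Ξ ((ω : V3), v, w) * hardSphereKernel (w, v) ω) sphereMeasure := by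
  refine integrable_sphereMeasure_of_continuous_V3 ?_
  unfold hardSphereKernel
  fun_prop

/-- **Monotonicity of the sphere-integrated mark** in the mark. [folklore] -/
theorem sphereMark_mono {Ξ₁ Ξ₂ : V3 × V3 × V3 → ℝ} (h₁ : Continuous Ξ₁) (h₂ : Continuous Ξ₂) (hle : ∀ q, Ξ₁ q ≤ Ξ₂ q)
    (v w : V3) : sphereMark Ξ₁ v w ≤ sphereMark Ξ₂ v w :=
  integral_mono (integrable_sphereIntegrand h₁ v w) (integrable_sphereIntegrand h₂ v w) fun ω =>
    mul_le_mul_of_nonneg_right (hle _) (hardSphereKernel_nonneg_le v w ω).1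

/-- **Additivity of the sphere-integrated mark** in the mark. [folklore] -/
theorem sphereMark_add {Ξ₁ Ξ₂ : V3 × V3 × V3 → ℝ} (h₁ : Continuous Ξ₁) (h₂ : Continuous Ξ₂) (v w : V3) :
    sphereMark (fun q => Ξ₁ q + Ξ₂ q) v w = sphereMark Ξ₁ v w + sphereMark Ξ₂ v w := by
  unfold sphereMark
  rw [← integral_add (integrable_sphereIntegrand h₁ v w) (integrable_sphereIntegrand h₂ v w)]
  refine integral_congr_ae (ae_of_all _ fun ω => ?_)
  ring

/-- The sphere-integrated mark of a nonnegative mark is nonnegative. [folklore] -/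
theorem sphereMark_nonneg' {Ξ : V3 × V3 × V3 → ℝ} (hΞ0 : ∀ q, 0 ≤ Ξ q) (v w : V3) : 0 ≤ sphereMark Ξ v w :=
  integral_nonneg fun ω => mul_nonneg (hΞ0 _) (hardSphereKernel_nonneg_le v w ω).1

/-- **Linear bound**: `Θ Ξ v w ≤ C |S²| ‖w − v‖` for `0 ≤ Ξ ≤ C` (the kernel is `≤ ‖w − v‖`). [folklore] -/
theorem sphereMark_le_mul_norm {Ξ : V3 × V3 × V3 → ℝ} (hΞ : Continuous Ξ) (hΞ0 : ∀ q, 0 ≤ Ξ q) {C : ℝ}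
    (hΞC : ∀ q, Ξ q ≤ C) (v w : V3) :
    sphereMark Ξ v w ≤ C * (sphereMeasure : Measure (Metric.sphere (0 : V3) 1)).real univ * ‖w - v‖ := by
  haveI := isFiniteMeasure_sphereMeasure (E := V3)
  have hC0 : 0 ≤ C := (hΞ0 0).trans (hΞC 0)
  have h : ∀ ω : Metric.sphere (0 : V3) 1, Ξ ((ω : V3), v, w) * hardSphereKernel (w, v) ω ≤ C * ‖w - v‖ := fun ω => by
    obtain ⟨hk0, hk1⟩ := hardSphereKernel_nonneg_le v w ω
    exact mul_le_mul (hΞC _) hk1 hk0 hC0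
  calc sphereMark Ξ v w ≤ ∫ _ω : Metric.sphere (0 : V3) 1, C * ‖w - v‖ ∂sphereMeasure :=
        integral_mono (integrable_sphereIntegrand hΞ v w) (integrable_const _) h
    _ = C * (sphereMeasure : Measure (Metric.sphere (0 : V3) 1)).real univ * ‖w - v‖ := by
        rw [integral_const, smul_eq_mul]; ring

/-! ## The speed cutoff: the bounded part and the tail of a mark -/

/-- The truncated mark `Ξ · ψ_L(‖v' − v‖)` is continuous. [folklore] -/
theorem continuous_truncMark {Ξ : V3 × V3 × V3 → ℝ} (hΞ : Continuous Ξ) (L : ℝ) :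
    Continuous fun q : V3 × V3 × V3 => Ξ q * speedCutoff L ‖q.2.2 - q.2.1‖ :=
  hΞ.mul ((show Continuous (speedCutoff L) by unfold speedCutoff; fun_prop).comp (by fun_prop))

/-- The tail mark `Ξ · (1 − ψ_L(‖v' − v‖))` is continuous. [folklore] -/
theorem continuous_tailMark {Ξ : V3 × V3 × V3 → ℝ} (hΞ : Continuous Ξ) (L : ℝ) :
    Continuous fun q : V3 × V3 × V3 => Ξ q * (1 - speedCutoff L ‖q.2.2 - q.2.1‖) :=
  hΞ.mul (continuous_const.sub ((show Continuous (speedCutoff L) by unfold speedCutoff; fun_prop).comp (by fun_prop)))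

/-- The truncated mark of `0 ≤ Ξ ≤ C` satisfies `|·| ≤ C`. [folklore] -/
theorem abs_truncMark_le {Ξ : V3 × V3 × V3 → ℝ} (hΞ0 : ∀ q, 0 ≤ Ξ q) {C : ℝ} (hΞC : ∀ q, Ξ q ≤ C) (L : ℝ)
    (q : V3 × V3 × V3) : |Ξ q * speedCutoff L ‖q.2.2 - q.2.1‖| ≤ C := by
  obtain ⟨h0, h1⟩ := speedCutoff_mem_Icc L ‖q.2.2 - q.2.1‖
  rw [abs_of_nonneg (mul_nonneg (hΞ0 q) h0)]
  exact (mul_le_of_le_one_right (hΞ0 q) h1).trans (hΞC q)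

/-- The truncated mark vanishes at relative speed `≥ 2L` (`L > 0`). [folklore] -/
theorem truncMark_eq_zero_of_le {Ξ : V3 × V3 × V3 → ℝ} {L : ℝ} (hL : 0 < L) (m v v' : V3) (h : 2 * L ≤ ‖v - v'‖) :
    Ξ (m, v, v') * speedCutoff L ‖(m, v, v').2.2 - (m, v, v').2.1‖ = 0 := by
  have h' : 2 * L ≤ ‖v' - v‖ := by rwa [norm_sub_rev]
  simp only [speedCutoff_eq_zero hL h', mul_zero]

/-- The tail mark is nonnegative and at most `Ξ`. [folklore] -/
theorem tailMark_nonneg_le {Ξ : V3 × V3 × V3 → ℝ} (hΞ0 : ∀ q, 0 ≤ Ξ q) (L : ℝ) (q : V3 × V3 × V3) :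
    0 ≤ Ξ q * (1 - speedCutoff L ‖q.2.2 - q.2.1‖) ∧ Ξ q * (1 - speedCutoff L ‖q.2.2 - q.2.1‖) ≤ Ξ q := by
  obtain ⟨h0, h1⟩ := speedCutoff_mem_Icc L ‖q.2.2 - q.2.1‖
  exact ⟨mul_nonneg (hΞ0 q) (by linarith), mul_le_of_le_one_right (hΞ0 q) (by linarith)⟩

/-- **The tail of the sphere-integrated mark is quadratically small**: for `0 ≤ Ξ ≤ C` and `L > 0`,
`Θ (Ξ(1 − ψ_L)) v w ≤ (C |S²| / L) ‖w − v‖²` (the tail mark is `≤ C 1{‖w − v‖ > L}`, the kernel `≤ ‖w − v‖`, and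
`‖w − v‖ 1{‖w − v‖ > L} ≤ ‖w − v‖²/L`). [folklore] -/
theorem sphereMark_tail_le {Ξ : V3 × V3 × V3 → ℝ} (hΞ : Continuous Ξ) (hΞ0 : ∀ q, 0 ≤ Ξ q) {C : ℝ}
    (hΞC : ∀ q, Ξ q ≤ C) {L : ℝ} (hL : 0 < L) (v w : V3) :
    sphereMark (fun q => Ξ q * (1 - speedCutoff L ‖q.2.2 - q.2.1‖)) v w ≤
      C * (sphereMeasure : Measure (Metric.sphere (0 : V3) 1)).real univ / L * ‖w - v‖ ^ 2 := by
  haveI := isFiniteMeasure_sphereMeasure (E := V3)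
  have hC0 : 0 ≤ C := (hΞ0 0).trans (hΞC 0)
  have hS0 : 0 ≤ (sphereMeasure : Measure (Metric.sphere (0 : V3) 1)).real univ := measureReal_nonneg
  by_cases hsmall : ‖w - v‖ ≤ L
  · -- the tail mark vanishes identically
    have h0 : ∀ m : V3, Ξ (m, v, w) * (1 - speedCutoff L ‖((m, v, w) : V3 × V3 × V3).2.2 - ((m, v, w) : V3 × V3 × V3).2.1‖) = 0 :=
      fun m => by simp only [speedCutoff_eq_one hL hsmall, sub_self, mul_zero]
    have : sphereMark (fun q => Ξ q * (1 - speedCutoff L ‖q.2.2 - q.2.1‖)) v w = 0 := by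
      simp only [sphereMark, h0, zero_mul, integral_zero]
    rw [this]
    positivity
  · push Not at hsmall
    have h1 := sphereMark_le_mul_norm (continuous_tailMark hΞ L) (fun q => (tailMark_nonneg_le hΞ0 L q).1) (C := C)
      (fun q => (tailMark_nonneg_le hΞ0 L q).2.trans (hΞC q)) v w
    refine h1.trans ?_
    have hquad : ‖w - v‖ ≤ ‖w - v‖ ^ 2 / L := by
      rw [le_div_iff₀ hL, sq]
      exact mul_le_mul_of_nonneg_left hsmall.le (norm_nonneg _)
    calc C * (sphereMeasure : Measure (Metric.sphere (0 : V3) 1)).real univ * ‖w - v‖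
        ≤ C * (sphereMeasure : Measure (Metric.sphere (0 : V3) 1)).real univ * (‖w - v‖ ^ 2 / L) :=
          mul_le_mul_of_nonneg_left hquad (mul_nonneg hC0 hS0)
      _ = _ := by ring

/-- `‖w − v‖² ≤ 2‖v‖² + 2‖w‖²`. [folklore] -/
theorem norm_sub_sq_le_two (v w : V3) : ‖w - v‖ ^ 2 ≤ 2 * ‖v‖ ^ 2 + 2 * ‖w‖ ^ 2 := by
  nlinarith [norm_sub_le w v, norm_nonneg (w - v), norm_nonneg v, norm_nonneg w, sq_nonneg (‖v‖ - ‖w‖)]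

/-! ## The pair functional: additivity, positivity, the pointwise tail bound -/

/-- **Additivity of the pair functional in the mark** (continuous marks). [folklore] -/
theorem pairFunctional_add {N : ℕ} (r : ℝ) {Ξ₁ Ξ₂ : V3 × V3 × V3 → ℝ} (h₁ : Continuous Ξ₁) (h₂ : Continuous Ξ₂)
    (z : Config (N + 1) (Fin 3) T3) (x₀ : T3) :
    pairFunctional r (fun q => Ξ₁ q + Ξ₂ q) z x₀ = pairFunctional r Ξ₁ z x₀ + pairFunctional r Ξ₂ z x₀ := by
  simp only [pairFunctional_eq_sum, sphereMark_add h₁ h₂, mul_add, Finset.sum_add_distrib]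

/-- The pair functional of a nonnegative mark is nonnegative (`r > 0`). [folklore] -/
theorem pairFunctional_nonneg {N : ℕ} {r : ℝ} (hr : 0 < r) {Ξ : V3 × V3 × V3 → ℝ} (hΞ0 : ∀ q, 0 ≤ Ξ q)
    (z : Config (N + 1) (Fin 3) T3) (x₀ : T3) : 0 ≤ pairFunctional r Ξ z x₀ := by
  rw [pairFunctional_eq_sum]
  refine mul_nonneg (by positivity) (Finset.sum_nonneg fun i _ => Finset.sum_nonneg fun j _ => ?_)
  exact mul_nonneg (mul_nonneg (coneKernel_nonneg_le hr _ _).1 (coneKernel_nonneg_le hr _ _).1) (sphereMark_nonneg' hΞ0 _ _)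

/-- **Pointwise bound on the tail pair functional**: for `0 ≤ Ξ ≤ C`, `L > 0`, `r > 0`,
`B_r (Ξ(1 − ψ_L)) (z, x₀) ≤ (4 M² C |S²| / L) · (N+1)⁻¹ Σᵢ ‖vᵢ‖²`, `M = 3/(πr³)`. [folklore] -/
theorem pairFunctional_tail_le {N : ℕ} {r : ℝ} (hr : 0 < r) {Ξ : V3 × V3 × V3 → ℝ} (hΞ : Continuous Ξ)
    (hΞ0 : ∀ q, 0 ≤ Ξ q) {C : ℝ} (hΞC : ∀ q, Ξ q ≤ C) {L : ℝ} (hL : 0 < L) (z : Config (N + 1) (Fin 3) T3) (x₀ : T3) :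
    pairFunctional r (fun q => Ξ q * (1 - speedCutoff L ‖q.2.2 - q.2.1‖)) z x₀ ≤
      4 * (3 / (Real.pi * r ^ 3)) ^ 2 * (C * (sphereMeasure : Measure (Metric.sphere (0 : V3) 1)).real univ / L) *
        ((((N + 1 : ℕ) : ℝ))⁻¹ * ∑ i, ‖(z i).2‖ ^ 2) := by
  haveI := isFiniteMeasure_sphereMeasure (E := V3)
  set M : ℝ := 3 / (Real.pi * r ^ 3) with hM
  set K : ℝ := C * (sphereMeasure : Measure (Metric.sphere (0 : V3) 1)).real univ / L with hK
  set n : ℝ := ((N + 1 : ℕ) : ℝ) with hn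
  have hn0 : 0 < n := by rw [hn]; positivity
  have hM0 : 0 ≤ M := by rw [hM]; positivity
  have hC0 : 0 ≤ C := (hΞ0 0).trans (hΞC 0)
  have hK0 : 0 ≤ K := by rw [hK]; exact div_nonneg (mul_nonneg hC0 measureReal_nonneg) hL.le
  have hb : ∀ i, 0 ≤ coneKernel r (z i).1 x₀ ∧ coneKernel r (z i).1 x₀ ≤ M := fun i => coneKernel_nonneg_le hr _ _
  -- each term
  have hterm : ∀ i j, coneKernel r (z i).1 x₀ * coneKernel r (z j).1 x₀ *
      sphereMark (fun q => Ξ q * (1 - speedCutoff L ‖q.2.2 - q.2.1‖)) (z i).2 (z j).2 ≤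
      M * M * (K * (2 * ‖(z i).2‖ ^ 2 + 2 * ‖(z j).2‖ ^ 2)) := by
    intro i j
    have h1 := sphereMark_tail_le hΞ hΞ0 hΞC hL (z i).2 (z j).2
    have h2 : sphereMark (fun q => Ξ q * (1 - speedCutoff L ‖q.2.2 - q.2.1‖)) (z i).2 (z j).2 ≤
        K * (2 * ‖(z i).2‖ ^ 2 + 2 * ‖(z j).2‖ ^ 2) :=
      h1.trans (mul_le_mul_of_nonneg_left (norm_sub_sq_le_two _ _) hK0)
    have h0 : 0 ≤ sphereMark (fun q => Ξ q * (1 - speedCutoff L ‖q.2.2 - q.2.1‖)) (z i).2 (z j).2 :=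
      sphereMark_nonneg' (fun q => (tailMark_nonneg_le hΞ0 L q).1) _ _
    exact mul_le_mul (mul_le_mul (hb i).2 (hb j).2 (hb j).1 hM0) h2 h0 (mul_nonneg hM0 hM0)
  rw [pairFunctional_eq_sum]
  have hsum : ∑ i, ∑ j, coneKernel r (z i).1 x₀ * coneKernel r (z j).1 x₀ *
      sphereMark (fun q => Ξ q * (1 - speedCutoff L ‖q.2.2 - q.2.1‖)) (z i).2 (z j).2 ≤
      ∑ i, ∑ j, M * M * (K * (2 * ‖(z i).2‖ ^ 2 + 2 * ‖(z j).2‖ ^ 2)) :=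
    Finset.sum_le_sum fun i _ => Finset.sum_le_sum fun j _ => hterm i j
  have hid : ∑ i : Fin (N + 1), ∑ j : Fin (N + 1), M * M * (K * (2 * ‖(z i).2‖ ^ 2 + 2 * ‖(z j).2‖ ^ 2)) =
      4 * M ^ 2 * K * (n * ∑ i, ‖(z i).2‖ ^ 2) := by
    have e1 : ∀ i : Fin (N + 1), ∑ j : Fin (N + 1), M * M * (K * (2 * ‖(z i).2‖ ^ 2 + 2 * ‖(z j).2‖ ^ 2)) =
        2 * M * M * K * (n * ‖(z i).2‖ ^ 2) + 2 * M * M * K * ∑ j, ‖(z j).2‖ ^ 2 := by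
      intro i
      simp only [mul_add, Finset.sum_add_distrib, Finset.sum_const, Finset.card_univ, Fintype.card_fin, nsmul_eq_mul,
        Finset.mul_sum, hn]
      ring
    simp only [e1, Finset.sum_add_distrib, Finset.sum_const, Finset.card_univ, Fintype.card_fin, nsmul_eq_mul, ← Finset.mul_sum,
      hn]
    ring
  calc (((N + 1 : ℕ) : ℝ))⁻¹ * (((N + 1 : ℕ) : ℝ))⁻¹ * ∑ i, ∑ j, coneKernel r (z i).1 x₀ * coneKernel r (z j).1 x₀ *
        sphereMark (fun q => Ξ q * (1 - speedCutoff L ‖q.2.2 - q.2.1‖)) (z i).2 (z j).2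
      ≤ n⁻¹ * n⁻¹ * (4 * M ^ 2 * K * (n * ∑ i, ‖(z i).2‖ ^ 2)) := by
        rw [← hid]
        exact mul_le_mul_of_nonneg_left hsum (by positivity)
    _ = 4 * M ^ 2 * K * (n⁻¹ * ∑ i, ‖(z i).2‖ ^ 2) := by
        field_simp

/-- **The truncated mark has a bounded sphere integral**: `|Θ (Ξψ_L) v w| ≤ C · 2L · |S²|` for `0 ≤ Ξ ≤ C`, `L > 0`
(the kernel is `≤ ‖w − v‖ < 2L` where the truncated mark is nonzero). [folklore] -/
theorem abs_sphereMark_truncMark_le {Ξ : V3 × V3 × V3 → ℝ} (hΞ0 : ∀ q, 0 ≤ Ξ q) {C : ℝ} (hΞC : ∀ q, Ξ q ≤ C)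
    {L : ℝ} (hL : 0 < L) (v w : V3) :
    |sphereMark (fun q => Ξ q * speedCutoff L ‖q.2.2 - q.2.1‖) v w| ≤
      C * (2 * L) * (sphereMeasure : Measure (Metric.sphere (0 : V3) 1)).real univ := by
  haveI := isFiniteMeasure_sphereMeasure (E := V3)
  have hC0 : 0 ≤ C := (hΞ0 0).trans (hΞC 0)
  have hpt : ∀ ω : Metric.sphere (0 : V3) 1,
      ‖(fun q : V3 × V3 × V3 => Ξ q * speedCutoff L ‖q.2.2 - q.2.1‖) ((ω : V3), v, w) * hardSphereKernel (w, v) ω‖ ≤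
        C * (2 * L) := by
    intro ω
    obtain ⟨hk0, hk1⟩ := hardSphereKernel_nonneg_le v w ω
    rw [Real.norm_eq_abs, abs_mul, abs_of_nonneg hk0]
    by_cases h : ‖v - w‖ < 2 * L
    · rw [norm_sub_rev] at h
      exact mul_le_mul (abs_truncMark_le hΞ0 hΞC L _) (hk1.trans h.le) hk0 hC0
    · push Not at h
      have h0 : (fun q : V3 × V3 × V3 => Ξ q * speedCutoff L ‖q.2.2 - q.2.1‖) ((ω : V3), v, w) = 0 :=
        truncMark_eq_zero_of_le (Ξ := Ξ) hL (ω : V3) v w h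
      rw [h0, abs_zero, zero_mul]
      positivity
  have h := norm_integral_le_of_norm_le_const (μ := (sphereMeasure : Measure (Metric.sphere (0 : V3) 1)))
    (f := fun ω : Metric.sphere (0 : V3) 1 =>
      (fun q : V3 × V3 × V3 => Ξ q * speedCutoff L ‖q.2.2 - q.2.1‖) ((ω : V3), v, w) * hardSphereKernel (w, v) ω)
    (C := C * (2 * L)) (Eventually.of_forall hpt)
  simpa only [Real.norm_eq_abs, sphereMark] using h

/-! ## Position statistics: the off-diagonal cone-weight pair average is close to `1` -/

/-- **The off-diagonal pair average versus the mollified density**: for weights `0 ≤ bᵢ ≤ M`, with `ρ̄ = n⁻¹ Σ bᵢ` and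
`Q = n⁻² Σ_{i≠j} bᵢ bⱼ = ρ̄² − n⁻² Σ bᵢ²`: `|Q − 1| ≤ (M + 1)|ρ̄ − 1| + M² n⁻¹`. [folklore] -/
theorem abs_offDiag_sub_one_le {n : ℕ} {M : ℝ} (hM : 0 ≤ M) (b : Fin n → ℝ) (hb : ∀ i, 0 ≤ b i ∧ b i ≤ M) :
    |(n : ℝ)⁻¹ * (n : ℝ)⁻¹ * (∑ i, ∑ j, if i = j then 0 else b i * b j) - 1| ≤
      (M + 1) * |(n : ℝ)⁻¹ * ∑ i, b i - 1| + M ^ 2 * (n : ℝ)⁻¹ := by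
  set ρ : ℝ := (n : ℝ)⁻¹ * ∑ i, b i with hρ
  set D : ℝ := (n : ℝ)⁻¹ * (n : ℝ)⁻¹ * ∑ i, b i ^ 2 with hD
  have hn0 : 0 ≤ (n : ℝ)⁻¹ := inv_nonneg.2 (Nat.cast_nonneg n)
  have hQ : (n : ℝ)⁻¹ * (n : ℝ)⁻¹ * ∑ i, ∑ j, (if i = j then 0 else b i * b j) = ρ ^ 2 - D := by
    have e : ∀ i : Fin n, ∑ j, (if i = j then (0 : ℝ) else b i * b j) = b i * ∑ j, b j - b i ^ 2 := by
      intro i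
      rw [Finset.mul_sum, ← Finset.sum_erase_add _ _ (Finset.mem_univ i), if_pos rfl, add_zero,
        ← Finset.sum_erase_add _ _ (Finset.mem_univ i), sq, add_sub_cancel_right]
      exact Finset.sum_congr rfl fun j hj => if_neg (Finset.ne_of_mem_erase hj).symm
    simp_rw [e, Finset.sum_sub_distrib, ← Finset.sum_mul]
    rw [hρ, hD]
    ring
  -- `0 ≤ ρ ≤ M` and `0 ≤ D ≤ M² n⁻¹`
  have hsum0 : 0 ≤ ∑ i, b i := Finset.sum_nonneg fun i _ => (hb i).1
  have hρ0 : 0 ≤ ρ := mul_nonneg hn0 hsum0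
  have hρM : ρ ≤ M := by
    rcases Nat.eq_zero_or_pos n with h0 | hpos
    · subst h0; simp [hρ, hM]
    · have hn : (0 : ℝ) < n := by exact_mod_cast hpos
      rw [hρ, inv_mul_le_iff₀ hn]
      calc ∑ i, b i ≤ ∑ _i : Fin n, M := Finset.sum_le_sum fun i _ => (hb i).2
        _ = n * M := by rw [Finset.sum_const, Finset.card_univ, Fintype.card_fin, nsmul_eq_mul]
  have hD0 : 0 ≤ D := mul_nonneg (mul_nonneg hn0 hn0) (Finset.sum_nonneg fun i _ => sq_nonneg _)
  have hDM : D ≤ M ^ 2 * (n : ℝ)⁻¹ := by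
    rcases Nat.eq_zero_or_pos n with h0 | hpos
    · subst h0; simp [hD]
    · have hn : (0 : ℝ) < n := by exact_mod_cast hpos
      have h1 : ∑ i, b i ^ 2 ≤ n * M ^ 2 := by
        calc ∑ i, b i ^ 2 ≤ ∑ _i : Fin n, M ^ 2 := Finset.sum_le_sum fun i _ =>
              pow_le_pow_left₀ (hb i).1 (hb i).2 2
          _ = n * M ^ 2 := by rw [Finset.sum_const, Finset.card_univ, Fintype.card_fin, nsmul_eq_mul]
      calc D = (n : ℝ)⁻¹ * (n : ℝ)⁻¹ * ∑ i, b i ^ 2 := rfl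
        _ ≤ (n : ℝ)⁻¹ * (n : ℝ)⁻¹ * (n * M ^ 2) := mul_le_mul_of_nonneg_left h1 (mul_nonneg hn0 hn0)
        _ = M ^ 2 * (n : ℝ)⁻¹ := by field_simp
  rw [hQ]
  have h1 : |ρ ^ 2 - 1| ≤ (M + 1) * |ρ - 1| := by
    rw [show ρ ^ 2 - 1 = (ρ + 1) * (ρ - 1) by ring, abs_mul, abs_of_nonneg (by linarith)]
    exact mul_le_mul_of_nonneg_right (by linarith) (abs_nonneg _)
  calc |ρ ^ 2 - D - 1| = |(ρ ^ 2 - 1) - D| := by ring_nf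
    _ ≤ |ρ ^ 2 - 1| + |D| := abs_sub _ _
    _ ≤ (M + 1) * |ρ - 1| + M ^ 2 * (n : ℝ)⁻¹ := add_le_add h1 (by rw [abs_of_nonneg hD0]; exact hDM)

/-- **Registered helper stub `stub_pairFunctionalTailLe`** of crux stmt-AtomisticToContinuum-13080 (line `Sketch`, input of `stub_staticOpacityFloorRung0`),
closed signature form of the file's main result. [folklore] -/
theorem stub_pairFunctionalTailLe : ∀ (N : ℕ) (r : ℝ), 0 < r → ∀ (Ξ : V3 × V3 × V3 → ℝ), Continuous Ξ → (∀ q, 0 ≤ Ξ q) → ∀ (C : ℝ), (∀ q, Ξ q ≤ C) → ∀ (L : ℝ), 0 < L → ∀ (z : Config (N + 1) (Fin 3) T3) (x₀ : T3), pairFunctional r (fun q => Ξ q * (1 - speedCutoff L ‖q.2.2 - q.2.1‖)) z x₀ ≤ 4 * (3 / (Real.pi * r ^ 3)) ^ 2 * (C * (sphereMeasure : MeasureTheory.Measure (Metric.sphere (0 : V3) 1)).real Set.univ / L) * ((((N + 1 : ℕ) : ℝ))⁻¹ * ∑ i, ‖(z i).2‖ ^ 2) :=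
  fun _N _r hr _Ξ hΞ hΞ0 _C hΞC _L hL z x₀ => pairFunctional_tail_le hr hΞ hΞ0 hΞC hL z x₀

end RateFloorPairFunctionalUpper

end Summit.AtomisticToContinuum.HydrodynamicLimit.Theorems

end
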